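import Mathlib
import HarnessLib
import Summits.NavierStokesRegularity.NavierStokesRegularity.Theorems.PlaneEnergyCeilingSlabEnergyIdentitySlab
import Summits.NavierStokesRegularity.NavierStokesRegularity.Theorems.PoloidalWindowDoorPoloidalWindowRigidityHorizontalMean

/-!
# Route `PoloidalWindowDoor`, crux `PoloidalWindowRigidity` (stmt-19708), line `sparse_energy` (cstrat g11) —
# a vertical window of horizontal-plane integrals is controlled by the integral over a ball (slab Fubini + scaling)

Seat ns-poloidal-K2-p2 g8 (interim LEAD-of-record on 19708; file `--supports`).  Measure-theoretic tool for the line's stub S3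
`stub_planeMeansVanish` (horizontal plane means of `|v|²` vanish at large scale when the scale-invariant energy is bounded):
for a continuous non-negative `F : ℝ³ → ℝ`, a centre `c`, a scale `R > 0`, a height `z`, a horizontal radius `r > 0` and a
half-thickness `h > 0`,

  `∫_{y ∈ B̄₂(0,r)} ∫_{s ∈ [−h,h]} F (pt c R z y + s e₂) ds dy ≤ R⁻² ∫_{B₃(c + z e₂, R r + h)} F`

(`pt c R z y = c + R·(y₀,y₁,0) + z e₂` is the plane parametrisation of `…HorizontalMean`).  Proof: translate the inner integral to
the height window `(c₂+z−h, c₂+z+h)`, rescale the plane variable (`Measure.setIntegral_comp_smul_of_pos`, factor `R⁻²`), and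
recognise the result as the slab-Fubini integral (`…PlaneEnergyCeilingSlabEnergyIdentity.setIntegral_slab_eq_integral_setIntegral`)
of `F` times the indicator of the solid cylinder `{|xₕ − cₕ| ≤ R r, |x₂ − c₂ − z| < h}`, which lies in the ball of radius `R r + h`
about `c + z e₂`.  Pure measure theory; no fluid mechanics.

WHAT THIS IS NOT: not a claim about Navier–Stokes — integral bookkeeping (bears_on LADDER-NS N0 via crux 19708, line sparse_energy).
-/

noncomputable section

-- the summit and its single sub-problem share the name (CONVENTIONS §1), as in every Theorems file
set_option linter.dupNamespace false

namespace Summit.NavierStokesRegularity.NavierStokesRegularity.Theorems.PoloidalWindowDoorPoloidalWindowRigiditySparseEnergySlabMean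

open MeasureTheory Set Function Filter Topology Metric WithLp
open scoped ENNReal
open Summit.NavierStokesRegularity.NavierStokesRegularity.Theorems.PlaneEnergyCeilingSlabEnergyIdentity
open Summit.NavierStokesRegularity.NavierStokesRegularity.Theorems.PoloidalWindowDoorPoloidalWindowRigidityHorizontalMean

/-! ### Coordinates -/

/-- The plane point `pt c R z y` moved up by `s`: coordinates `(c₀ + R y₀, c₁ + R y₁, c₂ + z + s)`. [folklore] -/
theorem pt_add_smul_single_two (c : EuclideanSpace ℝ (Fin 3)) (R z : ℝ) (y : EuclideanSpace ℝ (Fin 2)) (s : ℝ) :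
    pt c R z y + s • EuclideanSpace.single 2 1 =
      toLp 2 ![(toLp 2 ![c 0, c 1] + R • y : EuclideanSpace ℝ (Fin 2)) 0,
        (toLp 2 ![c 0, c 1] + R • y : EuclideanSpace ℝ (Fin 2)) 1, c 2 + z + s] := by
  ext k
  fin_cases k <;> simp [pt, hor_apply]

/-- Membership in a closed disc of `ℝ²` in coordinates. [folklore] -/
theorem mem_closedBall_iff_sq (y a : EuclideanSpace ℝ (Fin 2)) {ρ : ℝ} (hρ : 0 ≤ ρ) :
    y ∈ closedBall a ρ ↔ (y 0 - a 0) ^ 2 + (y 1 - a 1) ^ 2 ≤ ρ ^ 2 := by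
  rw [mem_closedBall, EuclideanSpace.dist_eq, Fin.sum_univ_two, Real.dist_eq, Real.dist_eq, sq_abs, sq_abs]
  constructor
  · intro h
    calc (y 0 - a 0) ^ 2 + (y 1 - a 1) ^ 2 = (Real.sqrt ((y 0 - a 0) ^ 2 + (y 1 - a 1) ^ 2)) ^ 2 :=
          (Real.sq_sqrt (by positivity)).symm
      _ ≤ ρ ^ 2 := by gcongr
  · intro h
    calc Real.sqrt ((y 0 - a 0) ^ 2 + (y 1 - a 1) ^ 2) ≤ Real.sqrt (ρ ^ 2) := Real.sqrt_le_sqrt h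
      _ = ρ := Real.sqrt_sq hρ

/-- The horizontal squared distance to `cₕ` is a continuous function on `ℝ³`. [folklore] -/
theorem continuous_horizSqDist (ch : EuclideanSpace ℝ (Fin 2)) :
    Continuous fun x : EuclideanSpace ℝ (Fin 3) => (x 0 - ch 0) ^ 2 + (x 1 - ch 1) ^ 2 := by
  have h0 : Continuous fun x : EuclideanSpace ℝ (Fin 3) => x 0 := (EuclideanSpace.proj (0 : Fin 3)).continuous
  have h1 : Continuous fun x : EuclideanSpace ℝ (Fin 3) => x 1 := (EuclideanSpace.proj (1 : Fin 3)).continuous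
  fun_prop

/-- The solid cylinder `{|xₕ − cₕ| ≤ ρ, m − h < x₂ < m + h}` lies in the ball of radius `ρ + h` about `(cₕ, m)`. [folklore] -/
theorem cylinder_subset_ball (ch : EuclideanSpace ℝ (Fin 2)) (m : ℝ) {ρ h : ℝ} (hρ : 0 ≤ ρ) (hh : 0 < h) :
    {x : EuclideanSpace ℝ (Fin 3) | (x 0 - ch 0) ^ 2 + (x 1 - ch 1) ^ 2 ≤ ρ ^ 2 ∧ m - h < x 2 ∧ x 2 < m + h} ⊆
      ball (toLp 2 ![ch 0, ch 1, m] : EuclideanSpace ℝ (Fin 3)) (ρ + h) := by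
  intro x hx
  obtain ⟨hsq, h1, h2⟩ := hx
  rw [mem_ball, EuclideanSpace.dist_eq, Fin.sum_univ_three, toLp_vec3_apply_zero, toLp_vec3_apply_one,
    toLp_vec3_apply_two, Real.dist_eq, Real.dist_eq, Real.dist_eq, sq_abs, sq_abs, sq_abs]
  have hv : (x 2 - m) ^ 2 < h ^ 2 := sq_lt_sq' (by linarith) (by linarith)
  have hlt : (x 0 - ch 0) ^ 2 + (x 1 - ch 1) ^ 2 + (x 2 - m) ^ 2 < (ρ + h) ^ 2 := by nlinarith
  calc Real.sqrt ((x 0 - ch 0) ^ 2 + (x 1 - ch 1) ^ 2 + (x 2 - m) ^ 2)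
      < Real.sqrt ((ρ + h) ^ 2) := Real.sqrt_lt_sqrt (by positivity) hlt
    _ = ρ + h := Real.sqrt_sq (by linarith)

/-! ### The one-dimensional and two-dimensional changes of variables -/

/-- Translating the height: `∫_{s ∈ [−h,h]} G(m + s) ds = ∫_{u ∈ (m−h, m+h)} G(u) du`. [folklore] -/
theorem setIntegral_Icc_comp_add (G : ℝ → ℝ) (m h : ℝ) :
    ∫ s in Icc (-h) h, G (m + s) = ∫ u in Ioo (m - h) (m + h), G u := by
  rw [integral_Icc_eq_integral_Ioo]
  have hpre : (fun s : ℝ => m + s) ⁻¹' Ioo (m - h) (m + h) = Ioo (-h) h := by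
    ext s; simp only [mem_preimage, mem_Ioo]; constructor <;> intro hs <;> constructor <;> linarith [hs.1, hs.2]
  have h := (measurePreserving_add_left (volume : Measure ℝ) m).setIntegral_preimage_emb
    (MeasurableEquiv.addLeft m).measurableEmbedding G (Ioo (m - h) (m + h))
  rw [← h]
  exact congrArg (fun S => ∫ s in S, G (m + s)) hpre.symm

/-- Rescaling and translating the plane variable: `∫_{B̄(0,r)} Ψ(a + R y) dy = R⁻² ∫_{B̄(a, R r)} Ψ`. [folklore] -/
theorem setIntegral_closedBall_comp_add_smul (Ψ : EuclideanSpace ℝ (Fin 2) → ℝ) (a : EuclideanSpace ℝ (Fin 2))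
    {R : ℝ} (hR : 0 < R) {r : ℝ} (hr : 0 ≤ r) :
    ∫ y in closedBall (0 : EuclideanSpace ℝ (Fin 2)) r, Ψ (a + R • y) =
      (R ^ 2)⁻¹ * ∫ y in closedBall a (R * r), Ψ y := by
  have h1 := Measure.setIntegral_comp_smul_of_pos (volume : Measure (EuclideanSpace ℝ (Fin 2)))
    (fun y => Ψ (a + y)) (closedBall (0 : EuclideanSpace ℝ (Fin 2)) r) hR
  rw [h1, finrank_euclideanSpace, Fintype.card_fin, smul_eq_mul]
  congr 1
  rw [_root_.smul_closedBall R (0 : EuclideanSpace ℝ (Fin 2)) hr, smul_zero, Real.norm_eq_abs, abs_of_pos hR]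
  have hpre : (fun y : EuclideanSpace ℝ (Fin 2) => a + y) ⁻¹' closedBall a (R * r) =
      closedBall (0 : EuclideanSpace ℝ (Fin 2)) (R * r) := by
    ext y; simp [mem_closedBall, dist_eq_norm]
  have h := (measurePreserving_add_left (volume : Measure (EuclideanSpace ℝ (Fin 2))) a).setIntegral_preimage_emb
    (MeasurableEquiv.addLeft a).measurableEmbedding Ψ (closedBall a (R * r))
  rw [hpre] at h
  exact h

/-! ### The window-versus-ball inequality -/

/-- **A vertical window of horizontal-plane integrals is controlled by a ball integral.**  For continuous `F ≥ 0` on `ℝ³`,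
`∫_{y ∈ B̄₂(0,r)} ∫_{s ∈ [−h,h]} F(pt c R z y + s e₂) ds dy ≤ R⁻² ∫_{B₃(c + z e₂, R r + h)} F`. [folklore] -/
theorem setIntegral_window_le_ball {F : EuclideanSpace ℝ (Fin 3) → ℝ} (hF : Continuous F) (hF0 : ∀ x, 0 ≤ F x)
    (c : EuclideanSpace ℝ (Fin 3)) {R : ℝ} (hR : 0 < R) (z : ℝ) {r : ℝ} (hr : 0 < r) {h : ℝ} (hh : 0 < h) :
    ∫ y in closedBall (0 : EuclideanSpace ℝ (Fin 2)) r, ∫ s in Icc (-h) h, F (pt c R z y + s • EuclideanSpace.single 2 1) ≤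
      (R ^ 2)⁻¹ * ∫ x in ball (c + z • EuclideanSpace.single 2 1) (R * r + h), F x := by
  set ch : EuclideanSpace ℝ (Fin 2) := toLp 2 ![c 0, c 1] with hch
  set m : ℝ := c 2 + z with hm
  -- the height-window integral over the vertical line through `y'`
  set Ψ : EuclideanSpace ℝ (Fin 2) → ℝ := fun y' => ∫ u in Ioo (m - h) (m + h),
    F (toLp 2 ![y' 0, y' 1, u]) with hΨ
  -- (1) the inner integral is `Ψ` at the rescaled plane point
  have hinner : ∀ y : EuclideanSpace ℝ (Fin 2),
      ∫ s in Icc (-h) h, F (pt c R z y + s • EuclideanSpace.single 2 1) = Ψ (ch + R • y) := by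
    intro y
    have hfun : (fun s => F (pt c R z y + s • EuclideanSpace.single 2 1)) =
        fun s => (fun u => F (toLp 2 ![(ch + R • y) 0, (ch + R • y) 1, u])) (m + s) := by
      funext s; rw [pt_add_smul_single_two, hm]
    rw [hfun]
    exact setIntegral_Icc_comp_add (fun u => F (toLp 2 ![(ch + R • y) 0, (ch + R • y) 1, u])) m h
  rw [setIntegral_congr_fun measurableSet_closedBall (fun y _ => hinner y),
    setIntegral_closedBall_comp_add_smul Ψ ch hR hr.le]
  refine mul_le_mul_of_nonneg_left ?_ (inv_nonneg.2 (sq_nonneg R))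
  -- (2) the cylinder and the slab
  set D : Set (EuclideanSpace ℝ (Fin 3)) := {x | (x 0 - ch 0) ^ 2 + (x 1 - ch 1) ^ 2 ≤ (R * r) ^ 2 ∧
    m - h < x 2 ∧ x 2 < m + h} with hD
  have hslabD : D ⊆ {x : EuclideanSpace ℝ (Fin 3) | m - h < x 2 ∧ x 2 < m + h} := fun x hx => hx.2
  have hDball : D ⊆ ball (c + z • EuclideanSpace.single 2 1) (R * r + h) := by
    have hc : (toLp 2 ![ch 0, ch 1, m] : EuclideanSpace ℝ (Fin 3)) = c + z • EuclideanSpace.single 2 1 := by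
      ext k; fin_cases k <;> simp [hch, hm]
    rw [← hc]
    exact cylinder_subset_ball ch m (by positivity) hh
  have hDmeas : MeasurableSet D := by
    have h1 : MeasurableSet {x : EuclideanSpace ℝ (Fin 3) | (x 0 - ch 0) ^ 2 + (x 1 - ch 1) ^ 2 ≤ (R * r) ^ 2} :=
      (isClosed_le (continuous_horizSqDist ch) continuous_const).measurableSet
    have h2 := measurableSet_slab (m - h) (m + h)
    have hD' : D = {x : EuclideanSpace ℝ (Fin 3) | (x 0 - ch 0) ^ 2 + (x 1 - ch 1) ^ 2 ≤ (R * r) ^ 2} ∩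
        {x : EuclideanSpace ℝ (Fin 3) | m - h < x 2 ∧ x 2 < m + h} := by
      ext x; simp only [hD, mem_setOf_eq, mem_inter_iff]
    rw [hD']; exact h1.inter h2
  -- integrability of `F` on the ball and of the cylinder-truncated `F` on `ℝ³`
  have hFball : IntegrableOn F (ball (c + z • EuclideanSpace.single 2 1) (R * r + h)) :=
    ((hF.continuousOn.integrableOn_compact (isCompact_closedBall _ _)).mono_set ball_subset_closedBall)
  have hg : Integrable (D.indicator F) := (integrable_indicator_iff hDmeas).2 (hFball.mono_set hDball)
  -- (3) slab Fubini for the truncated function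
  have hfub := setIntegral_slab_eq_integral_setIntegral hg (m - h) (m + h)
  have hin : ∀ y : EuclideanSpace ℝ (Fin 2),
      ∫ u in Ioo (m - h) (m + h), D.indicator F (toLp 2 ![y 0, y 1, u]) = (closedBall ch (R * r)).indicator Ψ y := by
    intro y
    by_cases hy : y ∈ closedBall ch (R * r)
    · rw [indicator_of_mem hy, hΨ]
      refine setIntegral_congr_fun measurableSet_Ioo fun u hu => ?_
      have hy' := (mem_closedBall_iff_sq y ch (by positivity)).1 hy
      have hmem : (toLp 2 ![y 0, y 1, u] : EuclideanSpace ℝ (Fin 3)) ∈ D := ⟨hy', hu.1, hu.2⟩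
      exact indicator_of_mem hmem F
    · rw [indicator_of_notMem hy]
      refine (setIntegral_congr_fun measurableSet_Ioo fun u _ => ?_).trans (integral_zero _ _)
      have hmem : (toLp 2 ![y 0, y 1, u] : EuclideanSpace ℝ (Fin 3)) ∉ D := by
        intro hD'; exact hy ((mem_closedBall_iff_sq y ch (by positivity)).2 hD'.1)
      exact indicator_of_notMem hmem F
  have hrhs : ∫ y : EuclideanSpace ℝ (Fin 2), ∫ u in Ioo (m - h) (m + h), D.indicator F (toLp 2 ![y 0, y 1, u]) =
      ∫ y in closedBall ch (R * r), Ψ y := by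
    rw [integral_congr_ae (Eventually.of_forall hin), integral_indicator measurableSet_closedBall]
  have hlhs : ∫ x in {x : EuclideanSpace ℝ (Fin 3) | m - h < x 2 ∧ x 2 < m + h}, D.indicator F x = ∫ x in D, F x := by
    rw [setIntegral_indicator hDmeas, inter_eq_right.2 hslabD]
  rw [← hrhs, ← hfub, hlhs]
  exact setIntegral_mono_set hFball (ae_of_all _ hF0) hDball.eventuallyLE

end Summit.NavierStokesRegularity.NavierStokesRegularity.Theorems.PoloidalWindowDoorPoloidalWindowRigiditySparseEnergySlabMean

end
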